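import Mathlib
import Summits.ValiantsHypothesis.ValiantsHypothesis.Theorems.KPlusLogSqLawWeakLiftingTowerGraftSkewBlockPhantoms
import Summits.ValiantsHypothesis.ValiantsHypothesis.Theorems.LacunarySymmetroidMatrixDescartesCensusDefs
import Summits.ValiantsHypothesis.ValiantsHypothesis.Theorems.KPlusLogSqLawWeakLiftingTowerGraftPivotCongruence
import Summits.ValiantsHypothesis.ValiantsHypothesis.Theorems.KPlusLogSqLawWeakLiftingTowerGraftKernelConfinement
import Literature.Combinatorics.SimpleGraph.CharpolyAdjugateSquareRoot
import Summits.ValiantsHypothesis.ValiantsHypothesis.Theorems.LacunarySymmetroidMatrixDescartesGramDualSplitting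

/-!
# Tower graft line — THE FOLD LAW FOR A RANK-TWO INDEFINITE FAR LETTER: folds of the axis-pair graft are CLASS events (T3, first piece)

Mechanism file for the line `Cruxes/WeakLifting/Lines/tower_graft.lean` (crux `WeakLifting` = stmt-ValiantsHypothesis-19561), memo
`Lines/tower_graft-S5.md` §1 (Ed) / §3 T3 «FOLD BUDGET (indefinite far letter) … No mechanism yet … OPEN; this is the load-bearing gap (price
P3)» and §1 «for indefinite `S` folds exist and `Disc` is NOT a determinant of the class».  NO stub is claimed.  THIS FILE: for the simplest
INDEFINITE far letter — the axis pair `S = Eᵢᵢ − Eⱼⱼ` (rank two, signature `(1,1)`; every rank-two indefinite letter `uuᵀ − vvᵀ` is congruent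
to it, cf. S4c `corner_reduction`) — the fold discriminant IS a product of two class determinants, so folds ARE paid by the class budget:

* §1 (any commutative ring, any finite index type; `G` symmetric where marked).  DIGITS `det_add_smul_single_sub_smul_single`:
  `det(G + T·(Eᵢᵢ − Eⱼⱼ)) = E₀ + T·E₁ + T²·E₂`, `E₀ = det G`, `E₁ = adjᵢᵢ − adjⱼⱼ`, `E₂ = −ε`, `ε = det G[{i,j}ᶜ]`
  (`det_updateRow_single_updateRow_single`); DESNANOT–JACOBI `det_mul_det_pairMinor`: `det G · ε = adjᵢᵢ adjⱼⱼ − adjᵢⱼ adjⱼᵢ` (the tree's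
  `CharpolyAdjugateSquareRoot.det_mul_det_submatrix_pair` [cite: HornJohnson2013, §0.8.11]); hence for symmetric `G` the FOLD DISCRIMINANT FACTORS
  (`foldDisc_eq_mul`): `E₁² − 4E₀E₂ = (adjᵢᵢ + adjⱼⱼ − 2adjᵢⱼ)(adjᵢᵢ + adjⱼⱼ + 2adjᵢⱼ)`; and each factor is a PRINCIPAL COFACTOR OF A CONGRUENT
  MATRIX (`adjugate_transvection`, `adjugate_transvection_conj_apply`, `foldFactor_sub_eq` / `foldFactor_add_eq`):
  `adjᵢᵢ + adjⱼⱼ ∓ 2adjᵢⱼ = adj(U±ᵀ G U±)ⱼⱼ`, `U± = transvection j i (±1)` — the determinant of the compression of `G` to `(eᵢ ∓ eⱼ)^⊥`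
  in the basis `e_k (k ≠ i, j), eᵢ ± eⱼ`.  `disc_eq_zero_of_double_root`: a fold (real double root of the fibre quadratic) is a zero of `E₁² − 4E₀E₂`.
* §2 (lacunary symmetric pencils `G = Σ X^{dₗ} Sₗ` of size `m+2` on any support `d`).  `card_posRoots_adjugate_conj_le`: each fold factor is
  the determinant of a SYMMETRIC pencil of size `m+1` ON THE SAME SUPPORT (letters `(U±ᵀ Sₗ U±).submatrix j.succAbove j.succAbove`), so it has
  at most `B` positive roots under `PosRootLawOn (m+1) K B d`; ★ **`card_posRoots_foldDisc_le`: `Z₊(E₁² − 4E₀E₂) ≤ B + B`** — THE FOLD LAW: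
  the abscissae of the folds of the graft curve `{det(G(t) + T·(Eᵢᵢ − Eⱼⱼ)) = 0}` are paid by the class budget one size down, factor `2`,
  NO additive term, every support, every exponent of the arc `T = t^D` (the arc plays no role); `card_posRoots_pairMinor_le`: the top digit
  `E₂ = −det G[{i,j}ᶜ]` (event (Er)) is a class determinant of size `m` (`≤ B` under `PosRootLawOn m K B d`).

READING.  With `E₀ = det G` (event (E0), size `m+2`), (Er) and (Ed) above, EVERY event type of the memo's §1 taxonomy is class-paid for this
graft: `#events ≤ ζ₊(m+2; d) + ζ₊(m; d) + 2·ζ₊(m+1; d) ≤ 4·ζ₊(m+2; d)` (size monotonicity p658112).  What is NOT bounded here is the number of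
intersections of the branches with the steep arc between events (the phantoms of the NO-GO ledger, p708324 & predecessors, which no
instance-level event count pays).  For far letters of rank ≥ 3 and mixed signature the isotropic cone `{w : wᵀSw = 0}` is not a union of
hyperplanes and no compression captures the folds — that is the next honest piece of T3.
HONEST FRAMING: exact linear algebra (Desnanot–Jacobi, transvections) + the class budget as a hypothesis; nothing on S4/S4b/S5/S5ᴸ, TowerB,
`WeakLifting`, Conjecture B, `MatrixDescartes` (18050) or `VP ≠ VNP`.  Def-free.  Seat: prover val-sym-lift-p2 g21,
`--supports stmt-ValiantsHypothesis-19561`.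
-/

-- `Summit.ValiantsHypothesis.ValiantsHypothesis.…` repeats a component by the D-0017 layout
-- (single-conjunct summit), which the `dupNamespace` linter flags; the name is mandated.
set_option linter.dupNamespace false

namespace Summit.ValiantsHypothesis.ValiantsHypothesis.Theorems.KPlusLogSqLaw.TowerGraft

open Polynomial Matrix
open scoped BigOperators Polynomial

/-! ## §1 The axis-pair graft: digits, Desnanot–Jacobi, the fold discriminant -/

section FoldAlgebra

variable {n : Type*} [Fintype n] [DecidableEq n] {R : Type*} [CommRing R]

/-- one diagonal corner in adjugate form: `det (G + c·Eᵢᵢ) = det G + c · adj(G)ᵢᵢ` (any finite index type). [folklore] -/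
theorem det_add_smul_single_eq_adjugate (G : Matrix n n R) (i : n) (c : R) :
    (G + c • Matrix.single i i (1 : R)).det = G.det + c * G.adjugate i i := by
  have h1 : G + c • Matrix.single i i (1 : R) = G.updateRow i (G i + c • Pi.single i (1 : R)) := by
    ext a b
    rcases eq_or_ne a i with rfl | ha
    · simp [Matrix.updateRow_self, Matrix.single, Pi.single_apply, eq_comm]
    · simp [Matrix.single, ha, ha.symm]
  rw [h1, Matrix.det_updateRow_add, Matrix.updateRow_eq_self, Matrix.det_updateRow_smul, Matrix.adjugate_apply]

omit [Fintype n] in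
/-- updating another row commutes with adding a corner. [folklore] -/
theorem updateRow_add_smul_single (G : Matrix n n R) {i j : n} (hij : i ≠ j) (c : R) (v : n → R) :
    (G + c • Matrix.single i i (1 : R)).updateRow j v = G.updateRow j v + c • Matrix.single i i (1 : R) := by
  ext a b
  rcases eq_or_ne a j with rfl | ha
  · simp [Matrix.updateRow_self, Matrix.single, hij]
  · simp [Matrix.updateRow_ne ha]

/-- **DIGITS OF THE AXIS-PAIR GRAFT**: `det (G + c·(Eᵢᵢ − Eⱼⱼ)) = det G + c·(adj(G)ᵢᵢ − adj(G)ⱼⱼ) − c²·ε` with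
`ε = det` of `G` with rows `i, j` replaced by `eᵢ, eⱼ` (the principal minor off `{i, j}`, see
`det_updateRow_single_updateRow_single`). [folklore] -/
theorem det_add_smul_single_sub_smul_single (G : Matrix n n R) {i j : n} (hij : i ≠ j) (c : R) :
    (G + c • Matrix.single i i (1 : R) - c • Matrix.single j j (1 : R)).det =
      G.det + c * (G.adjugate i i - G.adjugate j j) -
        c ^ 2 * ((G.updateRow i (Pi.single i (1 : R))).updateRow j (Pi.single j (1 : R))).det := by
  have e1 : G + c • Matrix.single i i (1 : R) - c • Matrix.single j j (1 : R) =
      (G + (-c) • Matrix.single j j (1 : R)) + c • Matrix.single i i (1 : R) := by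
    rw [neg_smul, sub_eq_add_neg]; abel
  have h1 : (G + (-c) • Matrix.single j j (1 : R)).det = G.det + (-c) * G.adjugate j j :=
    det_add_smul_single_eq_adjugate G j (-c)
  have h2 : (G + (-c) • Matrix.single j j (1 : R)).adjugate i i =
      G.adjugate i i + (-c) * ((G.updateRow i (Pi.single i (1 : R))).updateRow j (Pi.single j (1 : R))).det := by
    rw [Matrix.adjugate_apply, updateRow_add_smul_single G hij.symm, det_add_smul_single_eq_adjugate, Matrix.adjugate_apply,
      Matrix.adjugate_apply]
  rw [e1, det_add_smul_single_eq_adjugate, h1, h2]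
  ring

/-- replacing rows `i ≠ j` by the unit rows `eᵢ, eⱼ` leaves the principal minor off `{i, j}`. [folklore] -/
theorem det_updateRow_single_updateRow_single (G : Matrix n n R) {i j : n} (hij : i ≠ j) :
    ((G.updateRow i (Pi.single i (1 : R))).updateRow j (Pi.single j (1 : R))).det =
      (G.submatrix (Subtype.val : {a // a ≠ i ∧ a ≠ j} → n) Subtype.val).det := by
  set M := (G.updateRow i (Pi.single i (1 : R))).updateRow j (Pi.single j (1 : R)) with hM
  have hMi : M i = Pi.single i 1 := by rw [hM, Matrix.updateRow_ne hij, Matrix.updateRow_self]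
  have hMj : M j = Pi.single j 1 := by rw [hM, Matrix.updateRow_self]
  have hMr : ∀ r, r ≠ i → r ≠ j → M r = G r := fun r hri hrj => by
    rw [hM, Matrix.updateRow_ne hrj, Matrix.updateRow_ne hri]
  rw [Matrix.twoBlockTriangular_det M (fun a => a ≠ i ∧ a ≠ j)]
  · have h1 : M.toSquareBlockProp (fun a => a ≠ i ∧ a ≠ j) =
        G.submatrix (Subtype.val : {a // a ≠ i ∧ a ≠ j} → n) Subtype.val := by
      ext ⟨a, ha⟩ ⟨b, hb⟩
      simp [Matrix.toSquareBlockProp_def, hMr a ha.1 ha.2]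
    have h2 : M.toSquareBlockProp (fun a => ¬(a ≠ i ∧ a ≠ j)) = 1 := by
      ext ⟨a, ha⟩ ⟨b, hb⟩
      simp only [Matrix.toSquareBlockProp_def, Matrix.of_apply, Matrix.one_apply, Subtype.mk.injEq]
      have ha' : a = i ∨ a = j := by tauto
      rcases ha' with rfl | rfl
      · rw [hMi, Pi.single_apply]; simp [eq_comm]
      · rw [hMj, Pi.single_apply]; simp [eq_comm]
    rw [h1, h2, Matrix.det_one, mul_one]
  · intro r hr a ha
    have hr' : r = i ∨ r = j := by tauto
    rcases hr' with rfl | rfl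
    · rw [hMi, Pi.single_apply, if_neg ha.1]
    · rw [hMj, Pi.single_apply, if_neg ha.2]

/-- **Jacobi's 2 × 2 adjugate identity / Desnanot–Jacobi** in the form used here:
`det G · ε = adj(G)ᵢᵢ adj(G)ⱼⱼ − adj(G)ᵢⱼ adj(G)ⱼᵢ` (tree: `CharpolyAdjugateSquareRoot.det_mul_det_submatrix_pair`).
[cite: HornJohnson2013, §0.8.11] -/
theorem det_mul_det_pairMinor (G : Matrix n n R) {i j : n} (hij : i ≠ j) :
    G.det * ((G.updateRow i (Pi.single i (1 : R))).updateRow j (Pi.single j (1 : R))).det =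
      G.adjugate i i * G.adjugate j j - G.adjugate i j * G.adjugate j i := by
  rw [det_updateRow_single_updateRow_single G hij]
  exact Literature.Combinatorics.SimpleGraph.CharpolyAdjugateSquareRoot.det_mul_det_submatrix_pair G hij

/-- the adjugate of a symmetric matrix is symmetric. [folklore] -/
theorem adjugate_apply_comm_of_isSymm {G : Matrix n n R} (hG : G.IsSymm) (i j : n) : G.adjugate i j = G.adjugate j i := by
  have h := congrFun (congrFun (Matrix.adjugate_transpose G) j) i
  rw [Matrix.transpose_apply] at h
  rw [h]
  unfold Matrix.IsSymm at hG
  rw [hG]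

/-- **THE FOLD DISCRIMINANT FACTORS** (symmetric `G`): the discriminant in `T` of the graft quadratic
`det (G + T·(Eᵢᵢ − Eⱼⱼ)) = E₀ + T·E₁ + T²·E₂` is `E₁² − 4E₀E₂ = (adjᵢᵢ + adjⱼⱼ − 2 adjᵢⱼ)·(adjᵢᵢ + adjⱼⱼ + 2 adjᵢⱼ)`. [this work] -/
theorem foldDisc_eq_mul {G : Matrix n n R} (hG : G.IsSymm) {i j : n} (hij : i ≠ j) :
    (G.adjugate i i - G.adjugate j j) ^ 2 -
        4 * G.det * (-((G.updateRow i (Pi.single i (1 : R))).updateRow j (Pi.single j (1 : R))).det) =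
      (G.adjugate i i + G.adjugate j j - 2 * G.adjugate i j) * (G.adjugate i i + G.adjugate j j + 2 * G.adjugate i j) := by
  have h1 := det_mul_det_pairMinor G hij
  rw [← adjugate_apply_comm_of_isSymm hG i j] at h1
  linear_combination 4 * h1

/-! ### the two factors are principal cofactors of congruent matrices (compressions to `(eᵢ ∓ eⱼ)^⊥`) -/

/-- the adjugate of a transvection. [folklore] -/
theorem adjugate_transvection {i j : n} (hij : i ≠ j) (c : R) :
    (Matrix.transvection i j c).adjugate = Matrix.transvection i j (-c) := by
  have h1 : (Matrix.transvection i j c).adjugate * Matrix.transvection i j c = 1 := by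
    rw [Matrix.adjugate_mul, Matrix.det_transvection_of_ne i j hij c, one_smul]
  have h2 : Matrix.transvection i j c * Matrix.transvection i j (-c) = 1 := by
    rw [Matrix.transvection_mul_transvection_same i j hij, add_neg_cancel, Matrix.transvection_zero]
  calc (Matrix.transvection i j c).adjugate
      = (Matrix.transvection i j c).adjugate * (Matrix.transvection i j c * Matrix.transvection i j (-c)) := by
        rw [h2, Matrix.mul_one]
    _ = Matrix.transvection i j (-c) := by rw [← Matrix.mul_assoc, h1, Matrix.one_mul]

/-- **COMPRESSION FORMULA**: the `(j,j)` cofactor of the congruent matrix `Uᵀ G U`, `U = transvection j i c` (column `i ↦ eᵢ + c eⱼ`),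
is the quadratic form of `adj G` at `eⱼ − c eᵢ`: `adj(UᵀGU)ⱼⱼ = adjⱼⱼ − c (adjᵢⱼ + adjⱼᵢ) + c² adjᵢᵢ`. [this work] -/
theorem adjugate_transvection_conj_apply (G : Matrix n n R) {i j : n} (hji : j ≠ i) (c : R) :
    ((Matrix.transvection j i c)ᵀ * G * Matrix.transvection j i c).adjugate j j =
      G.adjugate j j - c * (G.adjugate i j + G.adjugate j i) + c ^ 2 * G.adjugate i i := by
  rw [Matrix.adjugate_mul_distrib, Matrix.adjugate_mul_distrib, ← Matrix.adjugate_transpose, adjugate_transvection hji,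
    Matrix.transvection_mul_apply_same]
  have hT : ∀ a : n, (G.adjugate * (Matrix.transvection j i (-c))ᵀ) a j = G.adjugate a j + (-c) * G.adjugate a i := by
    intro a
    have e : G.adjugate * (Matrix.transvection j i (-c))ᵀ = (Matrix.transvection j i (-c) * (G.adjugate)ᵀ)ᵀ := by
      rw [Matrix.transpose_mul, Matrix.transpose_transpose]
    rw [e, Matrix.transpose_apply, Matrix.transvection_mul_apply_same, Matrix.transpose_apply, Matrix.transpose_apply]
  rw [hT, hT]
  ring

/-- the two factors of the fold discriminant as principal cofactors of the compressions (`c = ∓1`, symmetric `G`). [this work] -/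
theorem foldFactor_eq_adjugate_conj {G : Matrix n n R} (hG : G.IsSymm) {i j : n} (hij : i ≠ j) (σ : R) (hσ : σ ^ 2 = 1) :
    G.adjugate i i + G.adjugate j j + 2 * σ * G.adjugate i j =
      ((Matrix.transvection j i (-σ))ᵀ * G * Matrix.transvection j i (-σ)).adjugate j j := by
  rw [adjugate_transvection_conj_apply G hij.symm, ← adjugate_apply_comm_of_isSymm hG i j, neg_sq, hσ]
  ring


/-- the two factors, sign by sign: `adjᵢᵢ + adjⱼⱼ − 2 adjᵢⱼ = adj(U₊ᵀ G U₊)ⱼⱼ`, `U₊ = transvection j i 1` (compression to `(eᵢ − eⱼ)^⊥`… in the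
basis `e_k (k ≠ i, j), eᵢ + eⱼ`), and `adjᵢᵢ + adjⱼⱼ + 2 adjᵢⱼ = adj(U₋ᵀ G U₋)ⱼⱼ`, `U₋ = transvection j i (−1)`. [this work] -/
theorem foldFactor_sub_eq {G : Matrix n n R} (hG : G.IsSymm) {i j : n} (hij : i ≠ j) :
    G.adjugate i i + G.adjugate j j - 2 * G.adjugate i j =
      ((Matrix.transvection j i (1 : R))ᵀ * G * Matrix.transvection j i (1 : R)).adjugate j j := by
  have h := foldFactor_eq_adjugate_conj hG hij (-1) (by ring)
  rw [neg_neg] at h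
  rw [← h]; ring

/-- the `+` fold factor as the `(j,j)` cofactor of the compression along `transvection j i (−1)`. [this work] -/
theorem foldFactor_add_eq {G : Matrix n n R} (hG : G.IsSymm) {i j : n} (hij : i ≠ j) :
    G.adjugate i i + G.adjugate j j + 2 * G.adjugate i j =
      ((Matrix.transvection j i (-1 : R))ᵀ * G * Matrix.transvection j i (-1 : R)).adjugate j j := by
  have h := foldFactor_eq_adjugate_conj hG hij 1 (by ring)
  rw [← h]; ring

/-- a real double root of the fibre quadratic `E₀ + T·E₁ + T²·E₂` (a FOLD of two real branches of the graft curve) is a zero of the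
discriminant. [folklore] -/
theorem disc_eq_zero_of_double_root (E₀ E₁ E₂ T₀ : ℝ) (h0 : E₀ + T₀ * E₁ + T₀ ^ 2 * E₂ = 0) (h1 : E₁ + 2 * T₀ * E₂ = 0) :
    E₁ ^ 2 - 4 * E₀ * E₂ = 0 := by
  have hE1 : E₁ = -(2 * T₀ * E₂) := by linarith
  rw [hE1] at h0 ⊢
  linear_combination (-4 * E₂) * h0

end FoldAlgebra

/-! ## §2 The fold law for lacunary symmetric pencils: folds of the axis-pair graft are CLASS events -/

section FoldLaw

open Summit.ValiantsHypothesis.ValiantsHypothesis.Theorems.LacunarySymmetroidMatrixDescartes (PosRootLawOn)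

/-- diagonal cofactor = principal minor (`Fin` indexing). [folklore] -/
theorem adjugate_apply_self_eq_det_submatrix {R : Type*} [CommRing R] {N : ℕ} (A : Matrix (Fin (N + 1)) (Fin (N + 1)) R)
    (j : Fin (N + 1)) : A.adjugate j j = (A.submatrix j.succAbove j.succAbove).det := by
  rw [Matrix.adjugate_fin_succ_eq_det_submatrix, ← two_mul, pow_mul, neg_one_sq, one_pow, one_mul]

/-- the lacunary symmetric pencil is symmetric. [folklore] -/
theorem isSymm_pencil {K N : ℕ} (d : Fin K → ℕ) (S : Fin K → Matrix (Fin N) (Fin N) ℝ) (hS : ∀ l, (S l).IsSymm) :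
    (∑ l, (X : ℝ[X]) ^ d l • (S l).map C).IsSymm := by
  unfold Matrix.IsSymm
  rw [Matrix.transpose_sum]
  refine Finset.sum_congr rfl fun l _ => ?_
  rw [Matrix.transpose_smul, ← Matrix.transpose_map, (hS l).eq]

/-- the real transvection mapped into `ℝ[X]`. [folklore] -/
theorem transvection_map_C {N : ℕ} (j i : Fin N) (r : ℝ) :
    (Matrix.transvection j i r).map (C : ℝ →+* ℝ[X]) = Matrix.transvection j i (C r) := by
  ext a b
  simp only [Matrix.transvection, Matrix.map_apply, Matrix.add_apply, Matrix.one_apply, Matrix.single_apply, map_add]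
  split_ifs <;> simp

/-- **A FOLD FACTOR IS A CLASS DETERMINANT.**  For the symmetric pencil `G = Σ X^{dₗ} Sₗ` of size `m+2` and `r : ℝ`, the cofactor
`adj((Uᵀ G U))ⱼⱼ` (`U = transvection j i r` over `ℝ[X]`) is the determinant of the SYMMETRIC pencil of size `m+1` on the SAME support with
letters `((transvection j i r)ᵀ Sₗ (transvection j i r)).submatrix j.succAbove j.succAbove`; hence it has at most `B` positive roots under
`PosRootLawOn (m+1) K B d`. [this work] -/
theorem card_posRoots_adjugate_conj_le {m K B : ℕ} (d : Fin K → ℕ) (hB : PosRootLawOn (m + 1) K B d)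
    (S : Fin K → Matrix (Fin (m + 2)) (Fin (m + 2)) ℝ) (hS : ∀ l, (S l).IsSymm) (j i : Fin (m + 2)) (r : ℝ) :
    ((((Matrix.transvection j i (C r))ᵀ * (∑ l, (X : ℝ[X]) ^ d l • (S l).map C) * Matrix.transvection j i (C r)).adjugate
        j j).roots.toFinset.filter (fun t => 0 < t)).card ≤ B := by
  rw [← transvection_map_C, transpose_mul_pencil_mul, adjugate_apply_self_eq_det_submatrix, submatrix_pencil']
  refine hB (fun l => ((Matrix.transvection j i r)ᵀ * S l * Matrix.transvection j i r).submatrix j.succAbove j.succAbove) fun l => ?_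
  exact (isSymm_transpose_mul_mul _ (hS l)).submatrix _

/-- **THE FOLD LAW (axis-pair graft; T3 of the line's memo for a rank-two indefinite far letter).**  Let `G = Σ X^{dₗ} Sₗ` be a symmetric
lacunary pencil of size `m+2`, `i ≠ j`, and graft the indefinite rank-two letter `Eᵢᵢ − Eⱼⱼ`: `det(G + T·(Eᵢᵢ − Eⱼⱼ)) = E₀ + T·E₁ + T²·E₂`
with `E₀ = det G`, `E₁ = adjᵢᵢ − adjⱼⱼ`, `E₂ = −det G[{i,j}ᶜ]` (`det_add_smul_single_sub_smul_single`; the exponent `D` of the arc `T = X^D`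
plays no role).  The FOLD DISCRIMINANT `E₁² − 4E₀E₂` — whose positive zeros contain every abscissa where two real branches of the graft curve
merge (`disc_eq_zero_of_double_root`) — is the PRODUCT of the determinants of the two compressions of `G` to `(eᵢ ∓ eⱼ)^⊥`
(`foldDisc_eq_mul`, `foldFactor_sub_eq`, `foldFactor_add_eq`), both symmetric pencils of size `m+1` on the same support; hence
**`Z₊(E₁² − 4E₀E₂) ≤ 2B` whenever `PosRootLawOn (m+1) K B d`** — folds are paid by the class budget, with factor `2` and NO additive term.
[this work] -/
theorem card_posRoots_foldDisc_le {m K B : ℕ} (d : Fin K → ℕ) (hB : PosRootLawOn (m + 1) K B d)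
    (S : Fin K → Matrix (Fin (m + 2)) (Fin (m + 2)) ℝ) (hS : ∀ l, (S l).IsSymm) {i j : Fin (m + 2)} (hij : i ≠ j) :
    ((((∑ l, (X : ℝ[X]) ^ d l • (S l).map C).adjugate i i - (∑ l, (X : ℝ[X]) ^ d l • (S l).map C).adjugate j j) ^ 2 -
        4 * (∑ l, (X : ℝ[X]) ^ d l • (S l).map C).det *
          (-(((∑ l, (X : ℝ[X]) ^ d l • (S l).map C).updateRow i (Pi.single i 1)).updateRow j
            (Pi.single j 1)).det)).roots.toFinset.filter (fun t => 0 < t)).card ≤ B + B := by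
  have hG := isSymm_pencil d S hS
  rw [foldDisc_eq_mul hG hij, foldFactor_sub_eq hG hij, foldFactor_add_eq hG hij]
  refine (Summit.ValiantsHypothesis.ValiantsHypothesis.Theorems.LacunarySymmetroidMatrixDescartes.GramDual.card_posRoots_mul_le _ _).trans (Nat.add_le_add ?_ ?_)
  · have h := card_posRoots_adjugate_conj_le d hB S hS j i 1
    rwa [map_one] at h
  · have h := card_posRoots_adjugate_conj_le d hB S hS j i (-1)
    rwa [map_neg, map_one] at h

/-- the principal minor off `{i, j}` of the pencil is a class determinant of size `m`: under `PosRootLawOn m K B d` the TOP DIGIT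
`E₂ = −det G[{i,j}ᶜ]` of the axis-pair graft (the event (Er): branches escaping to `T = ∞`) has at most `B` positive roots. [this work] -/
theorem card_posRoots_pairMinor_le {m K B : ℕ} (d : Fin K → ℕ) (hB : PosRootLawOn m K B d)
    (S : Fin K → Matrix (Fin (m + 2)) (Fin (m + 2)) ℝ) (hS : ∀ l, (S l).IsSymm) {i j : Fin (m + 2)} (hij : i ≠ j) :
    (((((∑ l, (X : ℝ[X]) ^ d l • (S l).map C).updateRow i (Pi.single i 1)).updateRow j
        (Pi.single j 1)).det).roots.toFinset.filter (fun t => 0 < t)).card ≤ B := by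
  classical
  rw [det_updateRow_single_updateRow_single _ hij]
  -- reindex the complement of `{i, j}` by `Fin m`
  have hcard : Fintype.card {a : Fin (m + 2) // a ≠ i ∧ a ≠ j} = m := by
    rw [Fintype.card_subtype]
    have e : (Finset.univ.filter fun a : Fin (m + 2) => a ≠ i ∧ a ≠ j) = Finset.univ \ {i, j} := by
      ext a
      simp [not_or]
    rw [e, Finset.card_sdiff_of_subset (Finset.subset_univ _), Finset.card_univ, Fintype.card_fin, Finset.card_pair hij]
    omega
  set e := Fintype.equivFinOfCardEq hcard with he
  rw [← Matrix.det_submatrix_equiv_self e.symm, Matrix.submatrix_submatrix, submatrix_pencil']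
  exact hB (fun l => (S l).submatrix (Subtype.val ∘ e.symm) (Subtype.val ∘ e.symm)) fun l => (hS l).submatrix _

end FoldLaw

end Summit.ValiantsHypothesis.ValiantsHypothesis.Theorems.KPlusLogSqLaw.TowerGraft
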